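import Summits.CriticalPhenomena.Ising3DConformalLimit.Theses.PerfectScreening
import Literature.Probability.LatticeModels.CriticalAxisRatioRegularity
import Literature.Probability.LatticeModels.PointwiseScalingLimitEtaExists
import Literature.Probability.LatticeModels.CriticalTwoPointLawDimension
import HarnessLib

/-!
# `SubharmonicOffOrigin` (crux stmt-CriticalPhenomena-1341): negative / tightness lemmas on the axis

Refuter file (cdisprove seat `refuter-cdisprove-stmt-CriticalPhenomena-1341-0`) for the crux
`SubH : ∀ x ≠ 0, 6·G(x) ≤ ∑ᵢ (G(x+eᵢ) + G(x−eᵢ))`, `G = criticalTwoPoint 3 = ⟨σ₀σ_x⟩⁺_{β_c(3)}`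
(route `PerfectScreening`). No statement of the route is asserted positively; every theorem is either
the negation of a VARIANT of SubH or an unconditional / conditional fact about the axis values
`G(n e₀)` that any proof of SubH has to respect.

* `subharmonicOffOrigin_false_without_neZero` — the only hypothesis `x ≠ 0` is LOAD-BEARING: with it
  dropped the statement is false at `x = 0` (`6 ≤ 6·G(e₀)` fails since `G(e₀) < 1`,
  `criticalTwoPoint_axis_one_lt_one`, from axis log-convexity `criticalTwoPoint_axis_sq_le` and
  `G → 0`).
* `eventually_nbrSum_axis_lt` — EXACT BALANCE ON THE AXIS (unconditional): for every `ε > 0`,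
  eventually `∑_nbrs G(n e₀) < (6+ε)·G(n e₀)`; ingredients: axis ratios `→ 1`
  (`criticalTwoPoint_axis_ratio_tendsto_one`, Aizenman–Duminil-Copin 2021 log-convexity + Simon–Lieb)
  and Messager–Miracle-Solé domination of the four transverse neighbours
  (`criticalTwoPoint_axis_sandwich`).
* `not_uniformlyStrictSubharmonic` — the natural STRENGTHENING `(6+ε)·G(x) ≤ ∑_nbrs G(x)` (`x ≠ 0`)
  is FALSE for every `ε > 0`: the constant `6` of SubH is sharp; no inequality with a uniform slack
  (local Simon–Lieb, Gaussian domination with a constant, graph comparisons) can prove SubH.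
* `tendsto_nbrSum_div_of_subharmonicOffOrigin` — CONDITIONAL: SubH forces
  `∑_nbrs G(n e₀) / G(n e₀) → 6` (`ΔG/G → 0⁺` on the axis).
(The quantitative form — the axis sum rule — is in the sibling file `AxisSumRule.lean`.)

References: M. Aizenman, H. Duminil-Copin, Ann. of Math. 194 (2021) [AizenmanDuminilCopinAnnals2021,
Prop. 5.3, §5.5]; A. Messager, S. Miracle-Solé, J. Stat. Phys. 17 (1977) [MessagerMiracleSoleJSP1977];
B. Simon, CMP 77 (1980) [Simon1980].
-/

noncomputable section

open Filter Topology Finset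
open Literature.Probability.LatticeModels

namespace Summit.CriticalPhenomena.Ising3DConformalLimit.SubharmonicOffOriginAxisBalance

/-! ### Axis toolkit -/

/-- Messager–Miracle-Solé in coordinates: a site with first coordinate `n ≥ 1` and all coordinates of
modulus `≤ n` (i.e. on the sup-sphere of radius `n`) has `G(y) ≤ G(n e₀)`. [folklore] -/
theorem le_axis_of_coords {n : ℕ} (hn : 1 ≤ n) {y : Site 3} (h0 : y 0 = n)
    (hle : ∀ j, (y j).natAbs ≤ n) :
    criticalTwoPoint 3 y ≤ criticalTwoPoint 3 (Pi.single 0 (n : ℤ)) := by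
  have hs : Site.supNorm y = n := by
    refine le_antisymm (Site.supNorm_le_iff.2 hle) ?_
    have h := Site.natAbs_le_supNorm y 0
    rwa [h0, Int.natAbs_natCast] at h
  have h := (criticalTwoPoint_axis_sandwich (y := y) (by omega)).2
  rwa [hs] at h

/-- The four transverse neighbours of `n e₀` (`n ≥ 1`) are dominated by `G(n e₀)`. [folklore] -/
theorem transverse_nbrs_le (n : ℕ) (hn : 1 ≤ n) :
    criticalTwoPoint 3 (Pi.single 0 (n : ℤ) + Pi.single 1 1) ≤ criticalTwoPoint 3 (Pi.single 0 (n : ℤ)) ∧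
    criticalTwoPoint 3 (Pi.single 0 (n : ℤ) - Pi.single 1 1) ≤ criticalTwoPoint 3 (Pi.single 0 (n : ℤ)) ∧
    criticalTwoPoint 3 (Pi.single 0 (n : ℤ) + Pi.single 2 1) ≤ criticalTwoPoint 3 (Pi.single 0 (n : ℤ)) ∧
    criticalTwoPoint 3 (Pi.single 0 (n : ℤ) - Pi.single 2 1) ≤ criticalTwoPoint 3 (Pi.single 0 (n : ℤ)) := by
  refine ⟨le_axis_of_coords hn (by simp) ?_, le_axis_of_coords hn (by simp) ?_,
    le_axis_of_coords hn (by simp) ?_, le_axis_of_coords hn (by simp) ?_⟩ <;>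
  · intro j
    fin_cases j <;> simp [hn]

/-- Axis bookkeeping: `n e₀ + e₀ = (n+1) e₀`. [folklore] -/
theorem axis_add_one (n : ℕ) :
    (Pi.single 0 (n : ℤ) + Pi.single 0 1 : Site 3) = Pi.single 0 ((n + 1 : ℕ) : ℤ) := by
  rw [← Pi.single_add]; push_cast; rfl

/-- Axis bookkeeping: `(n+1) e₀ − e₀ = n e₀`. [folklore] -/
theorem axis_sub_one (n : ℕ) :
    (Pi.single 0 ((n + 1 : ℕ) : ℤ) - Pi.single 0 1 : Site 3) = Pi.single 0 (n : ℤ) := by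
  rw [← Pi.single_sub]; push_cast; simp

/-- `n e₀ ≠ 0` for `n ≥ 1`. [folklore] -/
theorem axis_ne_zero {n : ℕ} (hn : 1 ≤ n) : (Pi.single 0 (n : ℤ) : Site 3) ≠ 0 := by
  intro h
  have h0 := congrFun h 0
  simp at h0
  omega

/-! ### (a) The hypothesis `x ≠ 0` is load-bearing -/

/-- `⟨σ₀σ_{e₀}⟩_{β_c(3)} < 1`: otherwise axis log-convexity (`criticalTwoPoint_axis_sq_le`) and
`G ≤ 1` force `G(n e₀) = 1` for all `n`, against `G → 0` (`criticalTwoPoint_tendsto_zero_cofinite`).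
[folklore] -/
theorem criticalTwoPoint_axis_one_lt_one : criticalTwoPoint 3 (Pi.single 0 ((1 : ℕ) : ℤ)) < 1 := by
  by_contra hge
  push Not at hge
  have h1 : criticalTwoPoint 3 (Pi.single 0 ((1 : ℕ) : ℤ)) = 1 :=
    le_antisymm (criticalTwoPoint_le_one' _) hge
  -- all axis values are 1
  have hall : ∀ n : ℕ, criticalTwoPoint 3 (Pi.single 0 ((n + 1 : ℕ) : ℤ)) = 1 := by
    intro n
    induction n with
    | zero => simpa using h1
    | succ n ih =>
      have hsq := criticalTwoPoint_axis_sq_le (0 : Fin 3) (n := n + 1) (by omega)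
      rw [show n + 1 - 1 = n by omega, ih, one_pow] at hsq
      have hle1 : criticalTwoPoint 3 (Pi.single 0 ((n : ℕ) : ℤ)) ≤ 1 := criticalTwoPoint_le_one' _
      have hnn : 0 ≤ criticalTwoPoint 3 (Pi.single 0 ((n + 1 + 1 : ℕ) : ℤ)) := criticalTwoPoint_nonneg' _
      have hle2 : criticalTwoPoint 3 (Pi.single 0 ((n + 1 + 1 : ℕ) : ℤ)) ≤ 1 := criticalTwoPoint_le_one' _
      nlinarith
  -- but G → 0 along the (injective) axis sequence
  have hinj : Function.Injective (fun n : ℕ => (Pi.single 0 ((n + 1 : ℕ) : ℤ) : Site 3)) := by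
    intro a b hab
    have h := congrFun hab 0
    simp at h
    omega
  have ht := criticalTwoPoint_tendsto_zero_cofinite.comp hinj.tendsto_cofinite
  rw [Nat.cofinite_eq_atTop] at ht
  have hev := ht.eventually (eventually_lt_nhds (by norm_num : (0 : ℝ) < 1 / 2))
  obtain ⟨n, hn⟩ := hev.exists
  simp only [Function.comp_apply] at hn
  rw [hall n] at hn
  norm_num at hn

/-- **`x ≠ 0` is load-bearing**: at the origin the inequality is `6 ≤ ∑_{|e|=1} G(e) = 6 G(e₀) < 6`.
[folklore] -/
theorem subharmonicOffOrigin_false_without_neZero :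
    ¬ ∀ x : Site 3, 6 * criticalTwoPoint 3 x ≤
      ∑ i : Fin 3, (criticalTwoPoint 3 (x + Pi.single i 1) + criticalTwoPoint 3 (x - Pi.single i 1)) := by
  intro h
  have h0 := h 0
  simp only [zero_add, zero_sub, criticalTwoPoint_zero', criticalTwoPoint_neg, Fin.sum_univ_three,
    mul_one] at h0
  have h1 := criticalTwoPoint_le_one' (d := 3) (Pi.single 1 1)
  have h2 := criticalTwoPoint_le_one' (d := 3) (Pi.single 2 1)
  have hlt := criticalTwoPoint_axis_one_lt_one
  simp only [Nat.cast_one] at hlt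
  linarith

/-! ### (b) Tightness: the neighbour sum on the axis is eventually `< (6+ε) G` -/

/-- **Exact balance on the axis (unconditional).** For every `ε > 0`, eventually in `n`,
`∑ᵢ (G(n e₀ + eᵢ) + G(n e₀ − eᵢ)) < (6 + ε) G(n e₀)`: the axial neighbours contribute ratios
`G((n±1)e₀)/G(ne₀) → 1` (`criticalTwoPoint_axis_ratio_tendsto_one`) and the four transverse ones are
`≤ G(n e₀)` (Messager–Miracle-Solé). Hence NO inequality with a uniform slack can prove SubH, and the
constant `6` cannot be improved. [folklore] -/
theorem eventually_nbrSum_axis_lt (ε : ℝ) (hε : 0 < ε) :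
    ∀ᶠ n : ℕ in atTop,
      ∑ i : Fin 3, (criticalTwoPoint 3 (Pi.single 0 (n : ℤ) + Pi.single i 1) +
          criticalTwoPoint 3 (Pi.single 0 (n : ℤ) - Pi.single i 1)) <
        (6 + ε) * criticalTwoPoint 3 (Pi.single 0 (n : ℤ)) := by
  set M : ℕ → ℝ := fun n => criticalTwoPoint 3 (Pi.single 0 (n : ℤ)) with hM
  have hpos : ∀ n, 0 < M n := criticalTwoPoint_axis_pos
  have hr : Tendsto (fun k : ℕ => M (k + 2) / M (k + 1)) atTop (𝓝 1) :=
    criticalTwoPoint_axis_ratio_tendsto_one (0 : Fin 3)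
  have hrinv : Tendsto (fun k : ℕ => M (k + 1) / M (k + 2)) atTop (𝓝 1) := by
    have h := hr.inv₀ one_ne_zero
    rw [inv_one] at h
    refine h.congr fun k => ?_
    rw [inv_div]
  have hr' : Tendsto (fun k : ℕ => M (k + 3) / M (k + 2)) atTop (𝓝 1) :=
    hr.comp (tendsto_add_atTop_nat 1)
  have hsum : Tendsto (fun k : ℕ => M (k + 3) / M (k + 2) + M (k + 1) / M (k + 2)) atTop (𝓝 (1 + 1)) :=
    hr'.add hrinv
  have hev : ∀ᶠ k : ℕ in atTop, M (k + 3) / M (k + 2) + M (k + 1) / M (k + 2) < 2 + ε :=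
    hsum.eventually (eventually_lt_nhds (by linarith))
  rw [eventually_atTop] at hev ⊢
  obtain ⟨K, hK⟩ := hev
  refine ⟨K + 2, fun n hn => ?_⟩
  obtain ⟨k, rfl⟩ : ∃ k, n = k + 2 := ⟨n - 2, by omega⟩
  have hk := hK k (by omega)
  have hM2 : 0 < M (k + 2) := hpos (k + 2)
  have hfrac : M (k + 3) + M (k + 1) < (2 + ε) * M (k + 2) := by
    rw [← add_div, div_lt_iff₀ hM2] at hk
    linarith
  obtain ⟨t1, t2, t3, t4⟩ := transverse_nbrs_le (k + 2) (by omega)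
  change _ ≤ M (k + 2) at t1 t2 t3 t4
  have hax1 : (Pi.single 0 ((k + 2 : ℕ) : ℤ) + Pi.single 0 1 : Site 3) = Pi.single 0 ((k + 3 : ℕ) : ℤ) :=
    axis_add_one (k + 2)
  have hax2 : (Pi.single 0 ((k + 2 : ℕ) : ℤ) - Pi.single 0 1 : Site 3) = Pi.single 0 ((k + 1 : ℕ) : ℤ) :=
    axis_sub_one (k + 1)
  rw [Fin.sum_univ_three, hax1, hax2]
  change M (k + 3) + M (k + 1) + _ + _ < (6 + ε) * M (k + 2)
  nlinarith [t1, t2, t3, t4, hfrac, hM2, hε]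

/-- **Refutation of the strengthening**: for every `ε > 0` the uniformly strict variant `(6+ε)·G ≤ ∑_nbrs G` is false —
the constant `6` in SubH is sharp (saturated along the axis). [folklore] -/
theorem not_uniformlyStrictSubharmonic {ε : ℝ} (hε : 0 < ε) :
    ¬ ∀ x : Site 3, x ≠ 0 → (6 + ε) * criticalTwoPoint 3 x ≤
      ∑ i : Fin 3, (criticalTwoPoint 3 (x + Pi.single i 1) + criticalTwoPoint 3 (x - Pi.single i 1)) := by
  intro h
  obtain ⟨n, hn1, hn⟩ := ((eventually_ge_atTop 1).and (eventually_nbrSum_axis_lt ε hε)).exists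
  exact absurd (h _ (axis_ne_zero hn1)) (not_le.2 hn)

/-- **Exact balance is forced by SubH (conditional)**: if SubH holds then along the axis
`∑_nbrs G(n e₀) / G(n e₀) → 6`, i.e. `ΔG/G → 0⁺` — any proof of SubH must be sharp to leading AND
next order on the axis. [folklore] -/
theorem tendsto_nbrSum_div_of_subharmonicOffOrigin
    (h : Summit.CriticalPhenomena.Ising3DConformalLimit.Theses.PerfectScreening.SubharmonicOffOrigin) :
    Tendsto (fun n : ℕ =>
      (∑ i : Fin 3, (criticalTwoPoint 3 (Pi.single 0 (n : ℤ) + Pi.single i 1) +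
          criticalTwoPoint 3 (Pi.single 0 (n : ℤ) - Pi.single i 1))) /
        criticalTwoPoint 3 (Pi.single 0 (n : ℤ))) atTop (𝓝 6) := by
  have hpos : ∀ n : ℕ, 0 < criticalTwoPoint 3 (Pi.single 0 (n : ℤ)) := criticalTwoPoint_axis_pos
  rw [tendsto_order]
  refine ⟨fun a ha => ?_, fun b hb => ?_⟩
  · filter_upwards [eventually_ge_atTop 1] with n hn
    have hx := h _ (axis_ne_zero hn)
    rw [lt_div_iff₀ (hpos n)]
    calc a * criticalTwoPoint 3 (Pi.single 0 (n : ℤ)) < 6 * criticalTwoPoint 3 (Pi.single 0 (n : ℤ)) :=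
          mul_lt_mul_of_pos_right ha (hpos n)
      _ ≤ _ := hx
  · filter_upwards [eventually_nbrSum_axis_lt (b - 6) (by linarith)] with n hn
    rw [div_lt_iff₀ (hpos n)]
    linarith

end Summit.CriticalPhenomena.Ising3DConformalLimit.SubharmonicOffOriginAxisBalance
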